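/-
Copyright (c) 2026. All rights reserved.
Released under Apache 2.0 license as described in the file LICENSE.
Authors: HodgeCM publication cell (pub-hodgecm), GR lane, seat own-crow (`pub-hodgecm-own-crow`).
-/
import Literature.NumberTheory.GelbartRogawski1991.UnitaryDualPairSplittingDatumCongruenceTransport
import Literature.NumberTheory.GelbartRogawski1991.Prop311AsPrintedOfArchHalf
import Literature.NumberTheory.QuadraticForms.HasseMinkowskiDiagonal
import HarnessLib

/-!
# [GelbartRogawski1991, Prop. 3.1.1] for ALL symmetric `F`-rational Gram data from the DIAGONAL case:
# `Prop311.SymmetricCompatibleSplitting ↔ Prop311.DiagonalCompatibleSplitting`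

Topic `NumberTheory/GelbartRogawski1991`; namespaces `Literature.NumberTheory.GelbartRogawski1991.Prop311` and
`….GRConstructionGen` (sequel of `Prop311AsPrintedOfRecord`, `Prop311AsPrintedOfArchHalf`,
`UnitaryDualPairSplittingDatumCongruenceTransport`).  Theorems only; no definition, no named fact, no `sorry`.

`Prop311AsPrintedOfRecord` records the END statement of the general-`(F, E, σ)` doubling construction of the compatible
splitting of [GelbartRogawski1991, Prop. 3.1.1] in two shapes: `Prop311.SymmetricCompatibleSplitting` (GR-2's telescope: all
symmetric invertible `T_V ∈ GL_N(F)`, `T_W ∈ GL_M(F)`) ⊇ `Prop311.DiagonalCompatibleSplitting` (diagonal data, the shape of the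
stage-1 record `gru_shape` and of the archimedean half under construction, `Prop311AsPrintedOfArchHalf`).  THIS FILE closes
the gap between them:

* **`Prop311.symmetricCompatibleSplitting_of_diagonalCompatibleSplitting`** — every symmetric matrix over `F` (`char F = 0`)
  is `F`-rationally congruent to an invertible diagonal one (an orthogonal basis of the quadratic space; Serre, Cours
  d'arithmétique Ch. IV §1.4; the tree's `QuadraticForms.exists_congr_diagonal`), and the record is invariant under
  `F`-rational congruence of the Gram data (`UnitaryDualPair.compatibleSplitting_congr`);
* `Prop311.symmetricCompatibleSplitting_iff_diagonalCompatibleSplitting`;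
* `GRConstructionGen.symmetricCompatibleSplitting_of_diagonalArchHalf` — the archimedean half for DIAGONAL data already
  yields the record for all symmetric data.

Nothing here is a claim of the manuscripts adjudicated by the Hodge-CM cell; `Prop311AsPrinted` is NOT inhabited here; HC_CM is
not touched.

## References
* [GelbartRogawski1991] S. Gelbart, J. Rogawski, Invent. Math. 105 (1991) 445–472, §3.1 Proposition 3.1.1 p. 455 L1–3, §3.2 p. 457.
* [Serre1973] J.-P. Serre, *A Course in Arithmetic*, GTM 7 (1973), Ch. IV §1.4 (orthogonal bases).
* [Kudla1994] S. Kudla, Israel J. Math. 87 (1994), §3 Thm. 3.1.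
-/

set_option autoImplicit false

noncomputable section

open scoped Matrix
open NumberField
open Literature.NumberTheory.Automorphic

namespace Literature.NumberTheory.GelbartRogawski1991

open Literature.NumberTheory.GaloisRepresentations Literature.RepresentationTheory.HarrisKudlaSweet1996

namespace Prop311

open UnitaryDualPair

/-- `Qᵀ (Pᵀ A P) Q = A` for `P Q = 1`: undoing a congruence. [cite: Serre1973, Ch. IV §1.4] -/
theorem congr_congr_eq_of_mul_eq_one {R : Type*} [CommRing R] {ι : Type*} [Fintype ι] [DecidableEq ι] {A P Q : Matrix ι ι R}
    (hPQ : P * Q = 1) : Qᵀ * (Pᵀ * A * P) * Q = A := by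
  rw [show Qᵀ * (Pᵀ * A * P) * Q = (P * Q)ᵀ * A * (P * Q) by rw [Matrix.transpose_mul]; simp only [Matrix.mul_assoc], hPQ,
    Matrix.transpose_one, Matrix.one_mul, Matrix.mul_one]

/-- **Symmetric data ⇐ diagonal data: `Prop311.DiagonalCompatibleSplitting → Prop311.SymmetricCompatibleSplitting`.**  Every
symmetric `T_V ∈ GL_N(F)`, `T_W ∈ GL_M(F)` is `F`-rationally congruent to an invertible DIAGONAL matrix (an orthogonal basis of
the quadratic space, `QuadraticForms.exists_congr_diagonal`: `P_Vᵀ T_V P_V = diag(c_V)`, all `c_{V,i} ≠ 0`), i.e.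
`T_V = Q_Vᵀ diag(c_V) Q_V` with `Q_V = P_V⁻¹`; the record for `(diag c_V, diag c_W)` is the hypothesis, and [GR91 Prop. 3.1.1] as a
record is invariant under `F`-rational congruence of the Gram data (`UnitaryDualPair.compatibleSplitting_congr`).  So the
END statement of the general doubling construction in GR-2's symmetric telescope follows from its diagonal form (the shape of
the stage-1 record `gru_shape` and of the archimedean half under construction). [cite: GelbartRogawski1991, §3.1 Proposition 3.1.1, p. 455 L1–3; §3.2 p. 457] -/
theorem symmetricCompatibleSplitting_of_diagonalCompatibleSplitting (h : DiagonalCompatibleSplitting) :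
    SymmetricCompatibleSplitting := by
  intro F _ _ E _ _ _ _ c δ hcδ hδ d hd N M n e TV hV hVd TW hW hWd
  obtain ⟨PV, QV, cV, hPQV, hQPV, hDV, hcV⟩ := QuadraticForms.exists_congr_diagonal TV hV
  obtain ⟨PW, QW, cW, hPQW, hQPW, hDW, hcW⟩ := QuadraticForms.exists_congr_diagonal TW hW
  have hcV0 : ∀ i, cV i ≠ 0 := hcV hVd.ne_zero
  have hcW0 : ∀ j, cW j ≠ 0 := hcW hWd.ne_zero
  have hQV : IsUnit QV.det := Matrix.isUnit_det_of_left_inverse hPQV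
  have hQW : IsUnit QW.det := Matrix.isUnit_det_of_left_inverse hPQW
  have hTV : QVᵀ * Matrix.diagonal cV * QV = TV := by rw [← hDV, congr_congr_eq_of_mul_eq_one hPQV]
  have hTW : QWᵀ * Matrix.diagonal cW * QW = TW := by rw [← hDW, congr_congr_eq_of_mul_eq_one hPQW]
  -- the record for the diagonal data, transported along the congruence `Q = P⁻¹`
  have h1 := compatibleSplitting_congr F E c e hcδ hδ hd (Matrix.isSymm_diagonal cV) (Matrix.isSymm_diagonal cW)
    (isUnit_det_diagonal_of_ne_zero cV hcV0) (isUnit_det_diagonal_of_ne_zero cW hcW0) hQV hQW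
    (h F E c δ hcδ hδ d hd N M n e cV hcV0 cW hcW0)
  exact (compatibleSplitting_splittingDatum_congr F E c N M e hcδ hδ hd hV hW hVd hWd rfl rfl
    (isSymm_congr (Matrix.isSymm_diagonal cV) QV) (isSymm_congr (Matrix.isSymm_diagonal cW) QW)
    (isUnit_det_congr (isUnit_det_diagonal_of_ne_zero cV hcV0) hQV)
    (isUnit_det_congr (isUnit_det_diagonal_of_ne_zero cW hcW0) hQW) rfl rfl hTV hTW
    (by rw [hTV]) (by rw [hTW])).2 h1

/-- **`Prop311.SymmetricCompatibleSplitting ↔ Prop311.DiagonalCompatibleSplitting`**: the two END statements of the general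
doubling construction (GR-2's symmetric telescope / its diagonal form) are equivalent.
[cite: GelbartRogawski1991, §3.1 Proposition 3.1.1, p. 455 L1–3] -/
theorem symmetricCompatibleSplitting_iff_diagonalCompatibleSplitting :
    SymmetricCompatibleSplitting ↔ DiagonalCompatibleSplitting :=
  ⟨diagonalCompatibleSplitting_of_symmetricCompatibleSplitting, symmetricCompatibleSplitting_of_diagonalCompatibleSplitting⟩

end Prop311

namespace GRConstructionGen

open UnitaryDualPair

/-- **the archimedean half for DIAGONAL data ⇒ the record for ALL symmetric `F`-rational Gram data**
(`Prop311.SymmetricCompatibleSplitting`, the general `gru_shape` in GR-2's telescope): `diagonalCompatibleSplitting_of_diagonalArchHalf`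
(`Prop311AsPrintedOfArchHalf`) followed by `symmetricCompatibleSplitting_of_diagonalCompatibleSplitting`.  So the programme's
archimedean half need only be built for diagonal hermitian data. [cite: GelbartRogawski1991, §3.1 Proposition 3.1.1 p. 455 L1–3; Kudla1994, Thm 3.1] -/
theorem symmetricCompatibleSplitting_of_diagonalArchHalf
    (harch : ∀ (F : Type) [Field F] [NumberField F] (E : Type) [Field E] [NumberField E] [Algebra F E]
      [Algebra.IsQuadraticExtension F E] (c : E ≃ₐ[F] E) {δ : E} (hcδ : c δ = -δ) (hδ : δ ≠ 0) {d : F}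
      (hd : δ * δ = algebraMap F E d) {N M n : ℕ} (e : Fin N × Fin M ≃ Fin n)
      (dV : Fin N → F) (hdV0 : ∀ i, dV i ≠ 0) (dW : Fin M → F) (hdW0 : ∀ j, dW j ≠ 0)
      (χ : HeckeCharacter E), χ.IsUnitary → IsSplittingCharExt F E 1 χ →
      ∃ sa, IsArchHalf F E c hcδ hδ hd e (Matrix.diagonal dV) (Matrix.isSymm_diagonal dV)
        (Prop311.isUnit_det_diagonal_of_ne_zero dV hdV0) (Matrix.diagonal dW) (Matrix.isSymm_diagonal dW)
        (Prop311.isUnit_det_diagonal_of_ne_zero dW hdW0) χ sa) :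
    Prop311.SymmetricCompatibleSplitting :=
  Prop311.symmetricCompatibleSplitting_of_diagonalCompatibleSplitting (diagonalCompatibleSplitting_of_diagonalArchHalf harch)

end GRConstructionGen

end Literature.NumberTheory.GelbartRogawski1991

end
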